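import Summits.QuantumFields.YangMills.Theorems.LatticeGapOnTrajectory.Negative.StubAnchoring
import Summits.QuantumFields.YangMills.Theorems.LatticeGapOnTrajectory.Negative.JunkCharts
import Literature.MathematicalPhysics.QuantumFieldTheory.LatticeGaugeProofs

/-!
# Stub 2 `BridgeChartExists` of the skeleton `dissipative-bridge` (crux `LatticeGapOnTrajectory`,
stmt-QuantumFields-10523): its tail-trapping certificate is formally idle; junk audit at the trivial group

Refuter (cdisprove gen 3) file on the Negative lane (sequel of `Negative.StubAnchoring`, whose copy `BridgeChart` of the
skeleton's posited object it reuses, with `InChart`, `tubeTop`, `Tube`, `TubeAdmissible` from `Negative.StubUVPassage`, and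
the trivial-group lemmas of `Negative.JunkCharts`;
`TrappingData`, `exists_tubeAdmissible`, `UniformLatticeGap` are copied here; `BridgeBody r` is the body of the
skeleton's `BridgeChartExists` after `IsCompactSimpleLieGroup G → ∀ r`).

* `bridgeBody_of_rcc`, `bridgeChartExists_of_rcc`: the body follows from a Bałaban chart `S` with odd block factor, an
  admissible tube, the UV pin `UVBound S Cuv` and running-coupling clustering `RunningCouplingClustering S γ κ c₁` alone,
  with the junk extension `X = ℝ × E`, `F = S.F`, `H = {g > γ/2}`, `P = id`, `J = 0`: AS TYPED, stub 2 = (∃ chart with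
  UV pin) ∧ (infrared lattice gap in running-coupling form); the computer-assisted enclosure is a proof METHOD for the
  clustering statement, not part of the stub's logical content.
* `trivialStep`, `bridgeBody_of_subsingleton`, `uniformLatticeGap_of_subsingleton`: at a subsingleton gauge group the
  hypothesis structure is inhabited for every `M ≥ 2`, the body of stub 2 holds (its fields are jointly satisfiable),
  and the hypothesis `UniformLatticeGap` of stub 4 is junk-true for every rate.
No route statement is asserted.
-/

namespace Summit.QuantumFields.YangMills.Theorems.LatticeGapOnTrajectory.Negative.Stubs

open Filter Topology MeasureTheory
open Literature.MathematicalPhysics.AQFT Literature.MathematicalPhysics.QuantumLattice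
open Literature.Probability.LatticeModels
open Literature.MathematicalPhysics.QuantumFieldTheory

noncomputable section

section Copies

variable {X : Type} [NormedAddCommGroup X] [NormedSpace ℝ X]

/-- COPY of `DissipativeBridge.TrappingData` (skeleton sha 4ba1ce0c). [folklore] -/
def TrappingData (F : X → X) (P : X →L[ℝ] X) (N : ℕ → Set X) (ρ θ η : ℝ) (J : ℕ) : Prop :=
  (∀ x, P (P x) = P x) ∧ 0 ≤ ρ ∧ 0 ≤ θ ∧ θ < 1 ∧ 0 ≤ η ∧ η ≤ (1 - θ) * ρ ∧
  (∀ i, ∀ x ∈ N i, P x = x) ∧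
  (∀ i < J, ∀ x ∈ N i, ∀ w : X, P w = 0 → ‖w‖ ≤ ρ →
      ‖F (x + w) - P (F (x + w))‖ ≤ θ * ‖w‖ + η) ∧
  (∀ i < J, ∀ x ∈ N i, ∀ w : X, P w = 0 → ‖w‖ ≤ ρ → P (F (x + w)) ∈ N (i + 1))

end Copies

section ChartCopies

variable {G : Type} [Group G] [TopologicalSpace G] [IsTopologicalGroup G] [CompactSpace G]
  [MeasurableSpace G] [BorelSpace G] {r : LatticeRep G} {M : ℕ} (S : BalabanBanachStep G r M)

/-- COPY of `DissipativeBridge.exists_tubeAdmissible`. [folklore] -/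
theorem exists_tubeAdmissible {ε : ℝ} (hε : 0 < ε) :
    ∃ γ ρ : ℝ, γ ≤ ε ∧ TubeAdmissible S γ ρ := by
  have hθ' := S.θ'_lt_one
  have hC := S.C_pos
  have h1θ : 0 < 1 - S.θ' := by linarith
  set K : ℝ := 2 * S.C / (1 - S.θ') + 1 with hK
  have hKpos : 0 < K := by positivity
  have ht0 : Tendsto (fun γ : ℝ => tubeTop S γ) (𝓝 0) (𝓝 0) := by
    have hc : Continuous fun γ : ℝ => tubeTop S γ := by unfold tubeTop; fun_prop
    simpa [tubeTop] using hc.tendsto 0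
  have ht : Tendsto (fun γ : ℝ => tubeTop S γ) (𝓝[>] 0) (𝓝 0) :=
    tendsto_nhdsWithin_of_tendsto_nhds ht0
  have hρ : Tendsto (fun γ : ℝ => K * tubeTop S γ ^ 2) (𝓝[>] 0) (𝓝 0) := by
    simpa using (ht.pow 2).const_mul K
  have h3 : Tendsto (fun γ : ℝ => S.C * (tubeTop S γ + K * tubeTop S γ ^ 2)) (𝓝[>] 0) (𝓝 0) := by
    simpa using (ht.add hρ).const_mul S.C
  have h4 : Tendsto (fun γ : ℝ => S.C * (tubeTop S γ + S.R) * tubeTop S γ ^ 2) (𝓝[>] 0) (𝓝 0) := by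
    simpa using ((ht.add_const S.R).const_mul S.C).mul (ht.pow 2)
  have e0 : ∀ᶠ γ in 𝓝[>] (0 : ℝ), γ ∈ Set.Ioo 0 ε := Ioo_mem_nhdsGT hε
  have e1 : ∀ᶠ γ in 𝓝[>] (0 : ℝ), K * tubeTop S γ ^ 2 ≤ S.R :=
    hρ.eventually (eventually_le_nhds S.R_pos)
  have e2 : ∀ᶠ γ in 𝓝[>] (0 : ℝ), tubeTop S γ ≤ S.δ := ht.eventually (eventually_le_nhds S.δ_pos)
  have e3 : ∀ᶠ γ in 𝓝[>] (0 : ℝ), S.C * (tubeTop S γ + K * tubeTop S γ ^ 2) ≤ S.b / 2 :=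
    h3.eventually (eventually_le_nhds (by linarith [S.b_pos]))
  have e4 : ∀ᶠ γ in 𝓝[>] (0 : ℝ), S.C * (tubeTop S γ + S.R) * tubeTop S γ ^ 2 ≤ 1 / 2 :=
    h4.eventually (eventually_le_nhds (by norm_num))
  obtain ⟨γ, hγ0, hγ1, hγ2, hγ3, hγ4⟩ := (e0.and (e1.and (e2.and (e3.and e4)))).exists
  have hγpos : 0 < γ := hγ0.1
  have htop : 0 < tubeTop S γ := hγpos.trans_le (le_tubeTop S hγpos.le)
  refine ⟨γ, K * tubeTop S γ ^ 2, hγ0.2.le, hγpos, by positivity, hγ1, hγ2, ?_, hγ3, hγ4⟩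
  have hKid : (1 - S.θ') * K = 2 * S.C + (1 - S.θ') := by
    rw [hK]; field_simp
  have hsq : 0 ≤ tubeTop S γ ^ 2 := sq_nonneg _
  calc 2 * S.C * tubeTop S γ ^ 2 ≤ (2 * S.C + (1 - S.θ')) * tubeTop S γ ^ 2 := by nlinarith
    _ = (1 - S.θ') * (K * tubeTop S γ ^ 2) := by rw [← hKid]; ring

end ChartCopies

section More

variable {G : Type} [Group G] [TopologicalSpace G] [IsTopologicalGroup G] [CompactSpace G]
  [MeasurableSpace G] [BorelSpace G] {r : LatticeRep G} {M' : ℕ}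

/-- COPY of `DissipativeBridge.UniformLatticeGap`. [folklore] -/
def UniformLatticeGap {ι : Type} (r : LatticeRep G) (sch : SpeciesScheme ι) (Δ : ℝ) : Prop :=
  ∃ k₀ : ℕ, ∀ A B : YMSpecies G, ∃ C : ℝ, ∀ k : ℕ, k₀ ≤ k → ∀ S : ℕ, sch.L k ≤ S →
    ∀ n : ℕ, n ≤ S →
      |latticeConnectedCorr r.ρ (sch.β k) (2 * S + 1) A.F B.F n| ≤
        C * Real.exp (-(Δ * (sch.a k * n)))


/-- The BODY of stub statement 2 at fixed `(G, r)` (everything after `IsCompactSimpleLieGroup G → ∀ r`).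
[folklore] -/
def BridgeBody {G : Type} [Group G] [TopologicalSpace G] [IsTopologicalGroup G] [CompactSpace G]
    [MeasurableSpace G] [BorelSpace G] (r : LatticeRep G) : Prop :=
  ∃ (M' : ℕ) (S : BalabanBanachStep G r M') (𝔛 : BridgeChart S)
    (γ ρ : ℝ), TubeAdmissible S γ ρ ∧
    ∃ (P : 𝔛.X →L[ℝ] 𝔛.X) (N : ℕ → Set 𝔛.X) (ρt θt ηt : ℝ) (J : ℕ),
      TrappingData 𝔛.F P N ρt θt ηt J ∧
      (∀ p ∈ Tube S γ ρ, P (𝔛.ι p) ∈ N 0 ∧ ‖𝔛.ι p - P (𝔛.ι p)‖ ≤ ρt) ∧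
      (∀ z : 𝔛.X, P z ∈ N J → ‖z - P z‖ ≤ ρt → z ∈ 𝔛.H)

end More

/-! ### §8.1 The certificate of stub 2 is formally idle: `BridgeBody ⇐ chart + UV pin + IR clustering` -/

section Idle

variable {G : Type} [Group G] [TopologicalSpace G] [IsTopologicalGroup G] [CompactSpace G]
  [MeasurableSpace G] [BorelSpace G] {r : LatticeRep G} {M' : ℕ}

/-- The UV output pin of the line, stated for the Bałaban chart `S` ITSELF (it never mentions the extension
`𝔛`): `D⁸ |⟨P ; τ_D P⟩_{β(g), 2L+1}| ≤ Cuv · g_i⁴` for `D ∈ [M'^i, M'^{i+1})`, `L ≥ M' D`, while the Wilson orbit is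
in the chart. [folklore] -/
def UVBound (S : BalabanBanachStep G r M') (Cuv : ℝ) : Prop :=
  ∀ g ∈ Set.Ioc 0 S.g₀, ∀ i : ℕ, InChart S (g, S.yW g) i →
    ∀ L D : ℕ, M' ^ i ≤ D → D < M' ^ (i + 1) → M' * D ≤ L →
      (D : ℝ) ^ 8 *
          |latticeConnectedCorr r.ρ (S.betaOf g) (2 * L + 1) r.curvature.F r.curvature.F D| ≤
        Cuv * ((S.F^[i] (g, S.yW g)).1) ^ 4

/-- **Running-coupling clustering** (the infrared lattice mass gap in asymptotic-scaling form, stated through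
the chart `S` only): once the running coupling of a Wilson orbit exceeds `γ/2` after `j + m` block steps, the
FINE Wilson theory at `β(g)` clusters at lattice rate `κ / M'^{j+m}` on every torus of side `≥ c₁ M'^{j+m}`.
The binding instance is the FIRST crossing of `γ/2` (it happens inside the chart, by the one-step bound
`remainder_basin`); later `m` only weaken the rate. [folklore] -/
def RunningCouplingClustering (S : BalabanBanachStep G r M') (γ κ : ℝ) (c₁ : ℕ) : Prop :=
  ∀ A B : YMSpecies G, ∃ C : ℝ, ∀ g ∈ Set.Ioc 0 S.g₀, ∀ j : ℕ, InChart S (g, S.yW g) j →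
    ∀ m : ℕ, γ / 2 < (S.F^[m] (S.F^[j] (g, S.yW g))).1 →
    ∀ T n : ℕ, c₁ * M' ^ (j + m) ≤ 2 * T + 1 → n ≤ T →
      |latticeConnectedCorr r.ρ (S.betaOf g) (2 * T + 1) A.F B.F n| ≤
        C * Real.exp (-(κ * n / (M' : ℝ) ^ (j + m)))

/-- **The junk bridge chart.** Over ANY Bałaban chart `S` with odd `M'`, the data `X = ℝ × E`, `F = S.F` (no
extension at all), `ι = id`, `H = {g > γ/2}` form a `BridgeChart S` as soon as the two output pins hold for `S`
itself (`UVBound`, `RunningCouplingClustering`). [folklore] -/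
def junkChart (S : BalabanBanachStep G r M') (hodd : Odd M') {γ κ : ℝ} (hκ : 0 < κ) {c₁ : ℕ} {Cuv : ℝ}
    (huv : UVBound S Cuv) (hrcc : RunningCouplingClustering S γ κ c₁) : BridgeChart S where
  odd_M := hodd
  X := ℝ × S.E
  F := S.F
  ι := id
  ι_step := fun _ _ _ => rfl
  H := {p | γ / 2 < p.1}
  isOpen_H := isOpen_lt continuous_const continuous_fst
  κ := κ
  κ_pos := hκ
  c₁ := c₁
  transport := hrcc
  Cuv := Cuv
  uv_bound := huv

/-- **Stub 2's certificate is idle.** Given a Bałaban chart with odd block factor, an admissible tube, the UV pin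
and running-coupling clustering, the BODY of `BridgeChartExists` holds — with the junk chart, the identity as
Galerkin projection, all boxes equal to `H = {g > γ/2} ⊇ Tube`, zero tail radius and `J = 0` steps: no enclosure,
no computation. Hence, AS TYPED, `stub_bridgeChart` is implied by (∃ chart with UV pin) ∧ (IR lattice gap beyond
the tube in running-coupling form); the Zgliczyński–Mischaikow certificate is a proof METHOD for the clustering
statement, not part of its logical content, and the line card's "why easier: finite-time, decidable by interval
arithmetic" is not a property of the typed `C⁺`. (Converse sandwich: the skeleton's `LatticeGapOnTrajectory_of`
derives AF-scaled clustering FROM the stub.) [folklore] -/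
theorem bridgeBody_of_rcc (S : BalabanBanachStep G r M') (hodd : Odd M') {γ ρ κ : ℝ}
    (hadm : TubeAdmissible S γ ρ) (hκ : 0 < κ) {c₁ : ℕ} {Cuv : ℝ} (huv : UVBound S Cuv)
    (hrcc : RunningCouplingClustering S γ κ c₁) : BridgeBody r := by
  refine ⟨M', S, junkChart S hodd hκ huv hrcc, γ, ρ, hadm, ContinuousLinearMap.id ℝ _,
    fun _ => {p : ℝ × S.E | γ / 2 < p.1}, 0, 0, 0, 0, ?_, ?_, ?_⟩
  · refine ⟨fun _ => rfl, le_rfl, le_rfl, zero_lt_one, le_rfl, by norm_num, fun _ _ _ => rfl,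
      fun i hi => absurd hi (Nat.not_lt_zero i), fun i hi => absurd hi (Nat.not_lt_zero i)⟩
  · intro p hp
    refine ⟨?_, by simp⟩
    show γ / 2 < p.1
    have hγ := hadm.1
    have hp1 : γ ≤ p.1 := hp.1
    linarith
  · intro z hz _
    exact hz

/-- The same, packaged as an implication between `∀ G r` statements: running-coupling clustering over some chart
(for every compact simple `G` and `r`) proves the skeleton's `BridgeChartExists` (whose body is `BridgeBody r`;
conclusion stated inline). [folklore] -/
theorem bridgeChartExists_of_rcc
    (h : ∀ (G : Type) [Group G] [TopologicalSpace G] [IsTopologicalGroup G] [CompactSpace G],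
      IsCompactSimpleLieGroup G →
      letI : MeasurableSpace G := borel G
      haveI : BorelSpace G := ⟨rfl⟩
      ∀ (r : LatticeRep G), ∃ (M' : ℕ) (S : BalabanBanachStep G r M') (γ ρ κ Cuv : ℝ) (c₁ : ℕ),
        Odd M' ∧ TubeAdmissible S γ ρ ∧ 0 < κ ∧ UVBound S Cuv ∧ RunningCouplingClustering S γ κ c₁) :
    ∀ (G : Type) [Group G] [TopologicalSpace G] [IsTopologicalGroup G] [CompactSpace G],
      IsCompactSimpleLieGroup G →
      letI : MeasurableSpace G := borel G
      haveI : BorelSpace G := ⟨rfl⟩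
      ∀ (r : LatticeRep G), BridgeBody r := by
  intro G _ _ _ _ hG
  letI : MeasurableSpace G := borel G
  haveI : BorelSpace G := ⟨rfl⟩
  intro r
  obtain ⟨M', S, γ, ρ, κ, Cuv, c₁, hodd, hadm, hκ, huv, hrcc⟩ := h G hG r
  exact bridgeBody_of_rcc S hodd hadm hκ huv hrcc

end Idle

/-! ### Junk audit at the trivial gauge group -/

section TrivialGroup

variable {G : Type} [Group G] [TopologicalSpace G] [IsTopologicalGroup G] [CompactSpace G]
  [MeasurableSpace G] [BorelSpace G]

/-- For a trivial (subsingleton) gauge group every lattice observable is constant, so every connected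
correlation vanishes identically. [folklore] -/
theorem latticeConnectedCorr_eq_zero_of_subsingleton [Subsingleton G] {N : ℕ}
    (ρ : G →* Matrix (Fin N) (Fin N) ℂ) (hρ : Continuous ρ) (β : ℝ) (S : ℕ) [NeZero S]
    (A B : LGConfig 4 G → ℝ) (n : ℕ) :
    latticeConnectedCorr ρ β S A B n = 0 := by
  haveI := isProbabilityMeasure_wilsonMeasure (d := 4) (L := S) ρ hρ β
  obtain ⟨a0, rfl⟩ : ∃ a0 : ℝ, A = fun _ => a0 := ⟨A 1, funext fun U => congrArg A (Subsingleton.elim _ _)⟩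
  obtain ⟨b0, rfl⟩ : ∃ b0 : ℝ, B = fun _ => b0 := ⟨B 1, funext fun U => congrArg B (Subsingleton.elim _ _)⟩
  unfold latticeConnectedCorr
  simp only [integral_const, smul_eq_mul, probReal_univ, one_mul]
  ring

/-- **The trivial-group junk chart.** For a subsingleton gauge group and ANY block factor `M ≥ 2`, the pure
parabolic normal form `φ g y = g + (log M) g³`, `Ψ ≡ 0` on `E = ℝ`, Wilson embedding `yW ≡ 0`, `β(g) = 1/g²`
and the constant realisation functional `expect ≡ [n = 0]` inhabit `BalabanBanachStep G r M`: all lattice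
fields are centred constants, so (4a)–(4c) hold trivially. Consequence for the skeleton: the `∀ G`-stubs
`UVPassage`, `ScaleAnchoring`, `LatticeToTransfer` quantify over a NON-EMPTY class of charts even before crux
stmt-9684 (`BalabanStepParabolic`) is inhabited, and their truth there is decided by pure dynamics / pure
Schwartz-space analysis. [folklore] -/
def trivialStep [Subsingleton G] (r : LatticeRep G) {M : ℕ} (hM : 2 ≤ M) : BalabanBanachStep G r M where
  E := ℝ
  φ := fun g _ => g + Real.log M * g ^ 3
  Ψ := fun _ _ => 0
  A := 0
  b := Real.log M
  θ := 0
  C := 1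
  δ := 1
  b_pos := Real.log_pos (by exact_mod_cast hM)
  θ_nonneg := le_rfl
  θ_lt_one := zero_lt_one
  C_pos := zero_lt_one
  δ_pos := zero_lt_one
  norm_A_le := by simp
  remainder := fun g y _ _ => by
    constructor
    · simp only [sub_self, abs_zero]; positivity
    · simp only [DB.hzeroCLM, sub_self, norm_zero]; positivity
  lipschitz_fibre := fun g y y' _ _ _ => by
    constructor
    · simp only [sub_self, abs_zero]; positivity
    · simp only [DB.hzeroCLM, sub_self, norm_zero]; positivity
  lipschitz_base := fun g g' y _ _ _ => by
    constructor
    · have : g + Real.log M * g ^ 3 - (g' + Real.log M * g' ^ 3) - (g - g') -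
          Real.log M * (g ^ 3 - g' ^ 3) = 0 := by ring
      rw [this, abs_zero]; positivity
    · simp only [sub_self, norm_zero]; positivity
  b₀ := 1
  b_eq := (one_mul _).symm
  R := 1
  δ_le_R := le_rfl
  θ' := 0
  θ'_nonneg := le_rfl
  θ'_lt_one := zero_lt_one
  contraction := fun _ _ _ _ _ _ => by simp
  remainder_basin := fun g y _ _ => by simp only [sub_self, abs_zero]; positivity
  yW := fun _ => 0
  g₀ := 1
  g₀_pos := zero_lt_one
  continuousOn_yW := continuousOn_const
  norm_yW_le := fun _ _ => by simp
  betaOf := fun g => 1 / g ^ 2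
  strictAntiOn_betaOf := fun a ha b hb hab =>
    one_div_lt_one_div_of_lt (pow_pos ha.1 2) (by nlinarith [ha.1, hb.1])
  continuousOn_betaOf :=
    continuousOn_const.div (continuousOn_pow 2) fun x hx => (pow_pos hx.1 2).ne'
  κ := 1
  κ_pos := zero_lt_one
  K := 0
  betaOf_sub_le := fun g _ => by simp
  c := fun _ _ => 1
  c_curvature := fun _ => rfl
  expect := fun _ _ n _ _ => if n = 0 then 1 else 0
  expect_step := fun _ _ _ _ _ _ _ _ => rfl
  expect_wilson := fun g _ L n σ f => (DB.wilsonCentredSchwinger_of_subsingleton r.ρ r.continuous _ L _ n σ f).symm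
  continuousOn_expect := fun _ _ _ _ _ => continuousOn_const

/-- Non-vacuity of the hypothesis structure at the trivial group, every `M ≥ 2`. [folklore] -/
theorem nonempty_balabanBanachStep_of_subsingleton [Subsingleton G] (r : LatticeRep G) {M : ℕ} (hM : 2 ≤ M) :
    Nonempty (BalabanBanachStep G r M) :=
  ⟨trivialStep r hM⟩

/-- **Stub 2's body is junk-inhabited at the trivial group** (`M' = 3`, the trivial chart, any admissible tube,
junk bridge chart with both pins true because every correlation vanishes): the fields of `BridgeChart` + the
certificate + the tube conditions are JOINTLY SATISFIABLE (no hidden inconsistency in the posited object), and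
all the content of `BridgeChartExists` sits in the two output pins being about an interacting Wilson theory.
The hypothesis `IsCompactSimpleLieGroup G` of stub 2 is not what excludes this junk (junk makes the body TRUE);
it is there for `U(1)`-type groups, where the body is expected to be false. [folklore] -/
theorem bridgeBody_of_subsingleton [Subsingleton G] (r : LatticeRep G) : BridgeBody r := by
  have h3 : (2 : ℕ) ≤ 3 := by norm_num
  obtain ⟨γ, ρ, -, hadm⟩ := exists_tubeAdmissible (trivialStep r h3) one_pos
  refine bridgeBody_of_rcc (trivialStep r h3) (by decide) hadm one_pos (c₁ := 0) (Cuv := 0) ?_ ?_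
  · intro g _ i _ L D _ _ _
    rw [latticeConnectedCorr_eq_zero_of_subsingleton r.ρ r.continuous, abs_zero, mul_zero, zero_mul]
  · intro A B
    refine ⟨0, fun g _ j _ m _ T n _ _ => ?_⟩
    rw [latticeConnectedCorr_eq_zero_of_subsingleton r.ρ r.continuous, abs_zero, zero_mul]

/-- At the trivial group the hypothesis `UniformLatticeGap` of stub 4 holds for EVERY scheme and EVERY rate
(infinite uniform gap), so `LatticeToTransfer` restricted there asserts: every OS datum that is a continuum
limit of the (deterministic, multiplicative) lattice Schwinger functions of constant fields has every mass gap
`Δ > 0` — a pure Schwartz-space density statement (off-diagonal real product tensors are total among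
time-ordered append tensors), believed true; no junk refutation of stub 4 through the trivial group. [folklore] -/
theorem uniformLatticeGap_of_subsingleton [Subsingleton G] {ι : Type} (r : LatticeRep G) (sch : SpeciesScheme ι)
    (Δ : ℝ) : UniformLatticeGap r sch Δ := by
  refine ⟨0, fun A B => ⟨0, fun k _ S _ n _ => ?_⟩⟩
  rw [latticeConnectedCorr_eq_zero_of_subsingleton r.ρ r.continuous, abs_zero, zero_mul]
end TrivialGroup

end

end Summit.QuantumFields.YangMills.Theorems.LatticeGapOnTrajectory.Negative.Stubs
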